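import Summits.CriticalPhenomena.CardyFormulaZ2.Theses.CardyBondTriangular
import Summits.CriticalPhenomena.CardyFormulaZ2.Theorems.CardyIKTransportCornerLineDescentFreezeContinuity
import Literature.Probability.LatticeModels.TriangularLatticeProofs
import HarnessLib

/-!
# The thinned collar-to-collar event on bond-`𝕋` lies in the crude crossing event (stub `stub_lowerCrossingTri_subset_crude`)

Route `CardyBondTriangular`, sub-problem `CriticalPhenomena/CardyFormulaZ2`, crux item
stmt-CriticalPhenomena-4665 (`CardyBondTriangular.TriangularToSquareTransport`), line `registered`
(skeleton `Cruxes/TriangularToSquareTransport/Lines/birth.lean`, reshaped), stub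
`stub_lowerCrossingTri_subset_crude`.

THE STATEMENT (deterministic run extraction on the triangular lattice `𝕋`).  Draw `𝕋 = triGraph` by
`z_𝕋 x = √3 · (triEmbed x − (1 + ζ)/3)` at mesh `δ > 0`, so that lattice edges have drawn length `√3 · δ`
(`dist_triDraw_eq_of_adj`, from `norm_triEmbed_eq_one_of_adj`).  Let `R` be a conformal rectangle
(`Ω = R.carrier`, arcs `R.arc 0`, `R.arc 2`), `κ` a collar scale with `√3 δ ≤ κ` and `ρ ≥ 0` a thinning
radius.  For every configuration `ω` supported on the edges of `triGraph` (an a.s. condition under bond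
percolation on `𝕋`): if `ω` has an open path all of whose vertices have their closed `ρ`-balls inside the
enlarged domain `Freeze.enlarge R κ = Ω ∪ collar₀ ∪ collar₂`, from a vertex whose ball lies in
`Freeze.sideCollar R 0 κ ∖ Ω` to a vertex whose ball lies in `Freeze.sideCollar R 2 κ ∖ Ω`, then `ω` lies in
the crude crossing event `embDomainCrossing z_𝕋 Ω δ (R.arc 0) (R.arc 2)` (an open path with all vertices
drawn in the OPEN domain `Ω`, from within `2δ` of `R.arc 0` to within `2δ` of `R.arc 2`).

THE PROOF is the bond-`ℤ²` model `Freeze.lowerCrossing_subset_embDomainCrossing` transcribed: centres lie in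
their balls (`Metric.mem_closedBall_self`), open edges are lattice edges (`ω ⊆ triGraph.edgeSet`) hence have
drawn length `√3 δ ≤ κ`, the generic geometric run extraction `Freeze.exists_crossing_run` (with `ℓ = √3 δ`)
produces a sub-walk drawn inside `Ω` from within `√3 δ` of `R.arc 0` to within `√3 δ` of `R.arc 2`, and
`√3 δ ≤ 2δ` converts the end conditions; `mem_openConnIn_iff_exists_openWalk` passes between `openConnIn`
and walks of the open graph.

LAYOUT.  `lowerCrossingTri_subset_crude` is the expanded statement; the registered stub lands under its
registered header `stub_lowerCrossingTri_subset_crude : Sig.stub_lowerCrossingTri_subset_crude`, with a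
`private` verbatim copy of the skeleton's `Sig.stub_lowerCrossingTri_subset_crude` (same pattern as
`CardyBondTriangularTriangularToSquareTransportStubBoundaryInsensitivitySq.lean`), so the skeleton's stub
closes by `exact`.

References: O. Schramm, S. Smirnov, *On the scaling limits of planar percolation*, Ann. Probab. 39 (2011)
§5–6; G. Grimmett, I. Manolescu, PTRF 159 (2014) §2.2 (`embDomainCrossing`); W. Werner, *Lectures on
two-dimensional critical percolation* (2009) §1 (the equilateral embedding of `𝕋`).
-/

noncomputable section

namespace Summit.CriticalPhenomena.CardyFormulaZ2.Theorems.TriangularToSquareTransport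

open Set
open Literature.Probability.RandomPlanarGeometry
open Literature.Probability.Percolation (BondConfig embDomainCrossing openGraph openGraph_adj openConnIn
  openCrossing)
open Literature.Probability.LatticeModels
open Summit.CriticalPhenomena.CardyFormulaZ2.Theorems.CornerLineDescent.SymmetricSeed

/-- Lengths of the edges of the triangular lattice drawn by `z_𝕋 x = √3 · (triEmbed x − (1 + ζ)/3)` at mesh
`δ`: `|δ| √3` (the equilateral embedding `triEmbed` has unit edges, `norm_triEmbed_eq_one_of_adj`).
[folklore] -/
theorem dist_triDraw_eq_of_adj {x y : Site 2} (h : triGraph.Adj x y) (δ : ℝ) :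
    dist ((δ : ℂ) * ((Real.sqrt 3 : ℂ) * (triEmbed x - (1 + triZeta) / 3)))
        ((δ : ℂ) * ((Real.sqrt 3 : ℂ) * (triEmbed y - (1 + triZeta) / 3))) = |δ| * Real.sqrt 3 := by
  rw [Complex.dist_eq, ← mul_sub, norm_mul, Complex.norm_real, Real.norm_eq_abs, ← mul_sub, norm_mul,
    Complex.norm_real, Real.norm_eq_abs, abs_of_nonneg (Real.sqrt_nonneg 3), sub_sub_sub_cancel_right,
    norm_triEmbed_eq_one_of_adj h, mul_one]

/-- **The thinned collar-to-collar event on bond-`𝕋` is below the crude event** (expanded form of the stub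
`stub_lowerCrossingTri_subset_crude` below).  For configurations `ω` supported on the edges of `triGraph`
and meshes with `0 < δ`, `√3 δ ≤ κ`, `0 ≤ ρ`: an open path of `𝕋` (drawn by
`z_𝕋 x = √3 · (triEmbed x − (1 + ζ)/3)` at mesh `δ`) whose vertices have their closed `ρ`-balls inside the
enlarged domain `Freeze.enlarge R κ`, from a vertex whose ball lies in `Freeze.sideCollar R 0 κ ∖ Ω` to one
whose ball lies in `Freeze.sideCollar R 2 κ ∖ Ω`, contains a crude crossing
`embDomainCrossing z_𝕋 Ω δ (R.arc 0) (R.arc 2)`: the path enters `Ω` through `R.arc 0` and leaves it through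
`R.arc 2` (`Freeze.exists_crossing_run` with edge length `√3 δ ≤ κ`), and its run inside `Ω` starts and
ends within one edge length `√3 δ ≤ 2δ` of the two arcs.  Mirror of the bond-`ℤ²` theorem
`Freeze.lowerCrossing_subset_embDomainCrossing`. [folklore] -/
theorem lowerCrossingTri_subset_crude :
    ∀ R : Literature.Probability.RandomPlanarGeometry.ConformalRectangle, ∀ κ ρ δ : ℝ, 0 < δ → 0 ≤ ρ →
      Real.sqrt 3 * δ ≤ κ → ∀ ω : Literature.Probability.Percolation.BondConfig (Literature.Probability.LatticeModels.Site 2), ω ⊆ Literature.Probability.LatticeModels.triGraph.edgeSet →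
        ω ∈ Literature.Probability.Percolation.openCrossing {x : Literature.Probability.LatticeModels.Site 2 | Metric.closedBall ((δ : ℂ) * ((Real.sqrt 3 : ℂ) * (Literature.Probability.LatticeModels.triEmbed x - (1 + Literature.Probability.LatticeModels.triZeta) / 3))) ρ ⊆ Summit.CriticalPhenomena.CardyFormulaZ2.Theorems.CornerLineDescent.SymmetricSeed.Freeze.enlarge R κ} {x : Literature.Probability.LatticeModels.Site 2 | Metric.closedBall ((δ : ℂ) * ((Real.sqrt 3 : ℂ) * (Literature.Probability.LatticeModels.triEmbed x - (1 + Literature.Probability.LatticeModels.triZeta) / 3))) ρ ⊆ Summit.CriticalPhenomena.CardyFormulaZ2.Theorems.CornerLineDescent.SymmetricSeed.Freeze.sideCollar R 0 κ \ R.carrier} {x : Literature.Probability.LatticeModels.Site 2 | Metric.closedBall ((δ : ℂ) * ((Real.sqrt 3 : ℂ) * (Literature.Probability.LatticeModels.triEmbed x - (1 + Literature.Probability.LatticeModels.triZeta) / 3))) ρ ⊆ Summit.CriticalPhenomena.CardyFormulaZ2.Theorems.CornerLineDescent.SymmetricSeed.Freeze.sideCollar R 2 κ \ R.carrier} →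
          ω ∈ Literature.Probability.Percolation.embDomainCrossing (fun x : Literature.Probability.LatticeModels.Site 2 ↦ (Real.sqrt 3 : ℂ) * (Literature.Probability.LatticeModels.triEmbed x - (1 + Literature.Probability.LatticeModels.triZeta) / 3)) R.carrier δ (R.arc 0) (R.arc 2) := by
  intro R κ ρ δ hδ hρ hκ ω hω h
  obtain ⟨u, hu, v, hv, huv⟩ := h
  rw [mem_openConnIn_iff_exists_openWalk] at huv
  obtain ⟨p, hp⟩ := huv
  set P : Site 2 → ℂ := fun x => (δ : ℂ) * ((Real.sqrt 3 : ℂ) * (triEmbed x - (1 + triZeta) / 3)) with hP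
  have hcen : ∀ x : Site 2, P x ∈ Metric.closedBall (P x) ρ := fun x => Metric.mem_closedBall_self hρ
  have hstep : ∀ x y, (openGraph ω).Adj x y → dist (P x) (P y) ≤ Real.sqrt 3 * δ := by
    intro x y hxy
    rw [openGraph_adj] at hxy
    have hadj : triGraph.Adj x y := by
      have := hω hxy.1
      rwa [SimpleGraph.mem_edgeSet] at this
    rw [hP, dist_triDraw_eq_of_adj hadj, abs_of_pos hδ, mul_comm]
  obtain ⟨a, b, q, hq, ha, hb⟩ := Freeze.exists_crossing_run P hκ hstep R p (hu (hcen u)) (hv (hcen v))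
    fun y hy => hp y hy (hcen y)
  have h2 : Real.sqrt 3 * δ ≤ 2 * δ := by
    have h32 : Real.sqrt 3 ≤ 2 := (Real.sqrt_le_left zero_le_two).2 (by norm_num)
    nlinarith
  refine ⟨a, ha.trans h2, b, hb.trans h2, ?_⟩
  rw [mem_openConnIn_iff_exists_openWalk]
  exact ⟨q, hq⟩

/-! ### The registered stub, under its registered header -/

/-- Signature of `stub_lowerCrossingTri_subset_crude`, verbatim the body of
`Sig.stub_lowerCrossingTri_subset_crude` of the registered skeleton of crux `TriangularToSquareTransport`
(line `registered`, `Cruxes/TriangularToSquareTransport/Lines/birth.lean`), so that the stub lands under the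
registered header `stub_lowerCrossingTri_subset_crude : Sig.stub_lowerCrossingTri_subset_crude` and closes
the skeleton's stub by `exact` (the two `Sig` definitions are syntactically, hence definitionally, equal).
Kept `private` so that sibling stub files may carry their own copy without a name clash on import; use
`lowerCrossingTri_subset_crude` for the expanded statement.  A statement only: it is the type of
`stub_lowerCrossingTri_subset_crude` below and is asserted nowhere else. -/
private def Sig.stub_lowerCrossingTri_subset_crude : Prop :=
    ∀ R : Literature.Probability.RandomPlanarGeometry.ConformalRectangle, ∀ κ ρ δ : ℝ, 0 < δ → 0 ≤ ρ →
      Real.sqrt 3 * δ ≤ κ → ∀ ω : Literature.Probability.Percolation.BondConfig (Literature.Probability.LatticeModels.Site 2), ω ⊆ Literature.Probability.LatticeModels.triGraph.edgeSet →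
        ω ∈ Literature.Probability.Percolation.openCrossing {x : Literature.Probability.LatticeModels.Site 2 | Metric.closedBall ((δ : ℂ) * ((Real.sqrt 3 : ℂ) * (Literature.Probability.LatticeModels.triEmbed x - (1 + Literature.Probability.LatticeModels.triZeta) / 3))) ρ ⊆ Summit.CriticalPhenomena.CardyFormulaZ2.Theorems.CornerLineDescent.SymmetricSeed.Freeze.enlarge R κ} {x : Literature.Probability.LatticeModels.Site 2 | Metric.closedBall ((δ : ℂ) * ((Real.sqrt 3 : ℂ) * (Literature.Probability.LatticeModels.triEmbed x - (1 + Literature.Probability.LatticeModels.triZeta) / 3))) ρ ⊆ Summit.CriticalPhenomena.CardyFormulaZ2.Theorems.CornerLineDescent.SymmetricSeed.Freeze.sideCollar R 0 κ \ R.carrier} {x : Literature.Probability.LatticeModels.Site 2 | Metric.closedBall ((δ : ℂ) * ((Real.sqrt 3 : ℂ) * (Literature.Probability.LatticeModels.triEmbed x - (1 + Literature.Probability.LatticeModels.triZeta) / 3))) ρ ⊆ Summit.CriticalPhenomena.CardyFormulaZ2.Theorems.CornerLineDescent.SymmetricSeed.Freeze.sideCollar R 2 κ \ R.carrier} →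
          ω ∈ Literature.Probability.Percolation.embDomainCrossing (fun x : Literature.Probability.LatticeModels.Site 2 ↦ (Real.sqrt 3 : ℂ) * (Literature.Probability.LatticeModels.triEmbed x - (1 + Literature.Probability.LatticeModels.triZeta) / 3)) R.carrier δ (R.arc 0) (R.arc 2)

/-- **Stub `stub_lowerCrossingTri_subset_crude`** (line `registered` of crux `TriangularToSquareTransport`,
stmt-CriticalPhenomena-4665): deterministic run extraction on bond-`𝕋` — for configurations on the edges of
`triGraph` and meshes with `0 < δ`, `√3 δ ≤ κ`, `0 ≤ ρ`, the thinned collar-to-collar event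
`lower_𝕋(R; κ, ρ; δ)` is contained in the crude crossing event
`embDomainCrossing z_𝕋 R.carrier δ (R.arc 0) (R.arc 2)` (see `lowerCrossingTri_subset_crude`; mirror of
`Freeze.lowerCrossing_subset_embDomainCrossing` via `Freeze.exists_crossing_run` and the `𝕋` edge length
`√3 δ ≤ 2δ`). [folklore] -/
theorem stub_lowerCrossingTri_subset_crude : Sig.stub_lowerCrossingTri_subset_crude :=
  lowerCrossingTri_subset_crude

end Summit.CriticalPhenomena.CardyFormulaZ2.Theorems.TriangularToSquareTransport

end
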